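import Summits.CriticalPhenomena.SAWScalingLimit.Theorems.SAWDefectDecoherenceBoundaryClosureRInnerZigzagSetup
import HarnessLib

/-!
# Crux `BoundaryClosureR` (stmt-CriticalPhenomena-14004), line `polygon-parity-squeeze`,
# stub `stub_innerZigzagPolygon` (7a): the face set `K = tileFaces S ∪ R₁ ∪ R₀` of the inner
# polygon — no pinch, the anchor dart, where its cells are

Landing target:
`Summits/CriticalPhenomena/SAWScalingLimit/Theorems/SAWDefectDecoherenceBoundaryClosureRInnerZigzagAssembly.lean`
(`--supports stmt-CriticalPhenomena-14004`; building block C3 of the registered stub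
`stub_innerZigzagPolygon`, the continuum half of the inner-polygon construction (IP)).

In normalised coordinates (`w`, real point `o + h·w`, `o = pt 1`, `p0n` the normalised `pt 0` on row
`N`, flat pinned balls of radii `ρ/h`, `r₁/h ≥ 4000`), the face set of the inner polygon is
`K = tileFaces S ∪ R₁ ∪ R₀`: the super-hexagon tiles with `5h`-deep centres and the two grid
trapezoids of `20` rows with bases `[-a, a] × {0}` and `[X₀ - a₀, X₀ + a₀] × {N}`,
`a = ⌊0.9ρ/h⌋`, `a₀ = ⌊0.9r₁/h⌋`.  Under the standing hypotheses of the section (listed once as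
`variable`s) this file proves:

* `K_noPinch` — `K` is pinch-free (`trapezoid_union_tiles_noPinch` at both pins — base corners off
  `Ω`, top corners `9h`-deep — and `union_two_noPinch`, the two trapezoids being `≥ (ρ + r₁)/h` apart);
* `d0_mem_bdDarts` — the dart `0 → triDir 0` along the gate from `pt 1` is a boundary dart of `K`;
* `K_cell_cases` — a point of a closed `K`-cell is in `Ω`, or on the gate base (`im = 0`, `‖w‖ ≤ a + 24`),
  or on the root base (`im = im p0n`, `‖w - p0n‖ ≤ a₀ + 49/2`).
(The companion facts — cells meeting the pinned half-balls or deep points are in `K` — are in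
`…InnerZigzagSetup.lean`.)

Sources: folklore.  No proposition is defined and no named fact is introduced.
-/

noncomputable section

open scoped ComplexConjugate
open Set Metric
open Literature.Probability.LatticeModels
open Literature.Probability.Percolation (triX triY triCell triCellStrict triX_triEmbed triY_triEmbed triDir
  triX_sub triY_sub)
open Literature.Probability.RandomPlanarGeometry
open Literature.Probability.RandomPlanarGeometry.SAW (site_two_eq_iff)
open Summit.CriticalPhenomena.SAWScalingLimit.Theorems.PolygonParitySqueeze.BoundaryWalk

namespace Summit.CriticalPhenomena.SAWScalingLimit.Theorems.PolygonParitySqueeze.InnerZigzag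

section Grid

variable {Ω : Set ℂ} {o p0n : ℂ} {h ρ r₁ : ℝ} {N X₀ a a₀ : ℤ} {S : Finset (Site 2)} {R₁ R₀ : Finset HexVertex}
  (hh : 0 < h) (hρ : 4000 * h ≤ ρ) (hr₁ : 4000 * h ≤ r₁)
  (hflat1 : ∀ w : ℂ, ‖w‖ < ρ / h → (o + h * w ∈ Ω ↔ 0 < w.im))
  (hflat0 : ∀ w : ℂ, ‖w - p0n‖ < r₁ / h → (o + h * w ∈ Ω ↔ p0n.im < w.im))
  (hp0n : triY p0n = N ∧ |triX p0n - X₀| ≤ 1 / 2)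
  (hdist : ρ / h + r₁ / h ≤ ‖p0n‖)
  (ha : (a : ℝ) ≤ 9 / 10 * (ρ / h) ∧ 9 / 10 * (ρ / h) - 1 < a)
  (ha₀ : (a₀ : ℝ) ≤ 9 / 10 * (r₁ / h) ∧ 9 / 10 * (r₁ / h) - 1 < a₀)
  (hS : ∀ c : Site 2, c ∈ S ↔ (c 0 - c 1) % 3 = 0 ∧ 5 * h ≤ infDist (o + h * triEmbed c) Ωᶜ)
  (hR₁ : ∀ F : HexVertex, F ∈ R₁ ↔
    ∀ v ∈ hexFaceVertices F, 0 ≤ v 1 ∧ v 1 ≤ 0 + 20 ∧ 0 - a ≤ v 0 ∧ (v 0 - 0) + (v 1 - 0) ≤ a)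
  (hR₀ : ∀ F : HexVertex, F ∈ R₀ ↔
    ∀ v ∈ hexFaceVertices F, N ≤ v 1 ∧ v 1 ≤ N + 20 ∧ X₀ - a₀ ≤ v 0 ∧ (v 0 - X₀) + (v 1 - N) ≤ a₀)
  (hdepth1 : ∀ w : ℂ, ‖w‖ < ρ / h → min (h * w.im) (ρ - h * ‖w‖) ≤ infDist (o + h * w) Ωᶜ)
  (hdepth0 : ∀ w : ℂ, ‖w - p0n‖ < r₁ / h → min (h * (w - p0n).im) (r₁ - h * ‖w - p0n‖) ≤ infDist (o + h * w) Ωᶜ)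

/-! ### 1. Norms of lattice points against the two pins -/

omit hh in
/-- `√3 ≤ 2` and `17/10 ≤ √3`. [folklore] -/
theorem sqrt_three_bounds : Real.sqrt 3 ≤ 2 ∧ (17 : ℝ) / 10 ≤ Real.sqrt 3 := by
  constructor
  · rw [show (2 : ℝ) = Real.sqrt 4 by rw [show (4 : ℝ) = 2 ^ 2 by norm_num, Real.sqrt_sq (by norm_num)]]
    exact Real.sqrt_le_sqrt (by norm_num)
  · rw [Real.le_sqrt (by norm_num) (by norm_num)]; norm_num

omit hh in
/-- **A point at controlled lattice offset from the root pin**: if `0 ≤ Y(u - p0n) ≤ 20` and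
`|X(u) - X₀| ≤ A` then `‖u - p0n‖ ≤ A + 61/2`, and `im (u - p0n) = (√3/2)·Y(u - p0n)`. [folklore] -/
theorem norm_sub_p0n_le (hp0n : triY p0n = N ∧ |triX p0n - X₀| ≤ 1 / 2) {u : ℂ} {A : ℝ}
    (hY : 0 ≤ triY (u - p0n) ∧ triY (u - p0n) ≤ 20) (hX : |triX u - X₀| ≤ A) : ‖u - p0n‖ ≤ A + 61 / 2 := by
  obtain ⟨s2, -⟩ := sqrt_three_bounds
  have hre := re_eq_triX_add (u - p0n)
  have him := im_eq_triY (u - p0n)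
  rw [triX_sub] at hre
  have h1 := abs_le.1 hX
  have h2 := abs_le.1 hp0n.2
  have hre' : |(u - p0n).re| ≤ A + 1 / 2 + 10 := by
    rw [hre, abs_le]; constructor <;> linarith
  have him' : |(u - p0n).im| ≤ 20 := by
    rw [him, abs_le]; constructor <;> nlinarith [Real.sqrt_nonneg 3]
  linarith [Complex.norm_le_abs_re_add_abs_im (u - p0n)]

omit hh in
/-- The lattice coordinates of `triEmbed v - p0n`. [folklore] -/
theorem coords_triEmbed_sub (hp0n : triY p0n = N ∧ |triX p0n - X₀| ≤ 1 / 2) (v : Site 2) :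
    triY (triEmbed v - p0n) = v 1 - N ∧ triX (triEmbed v - p0n) = (v 0 - X₀) + (X₀ - triX p0n) := by
  rw [triY_sub, triX_sub, triY_triEmbed, triX_triEmbed, hp0n.1]
  exact ⟨rfl, by ring⟩

/-! ### 2. The corner hypotheses of the two trapezoids -/

include hh hρ hflat1 hS ha in
/-- No tile at the base corners of the gate trapezoid (they are on the gate line, off `Ω`). [folklore] -/
theorem base_corners_one : (∀ k : Fin 6, faceL ![0 - a, 0] k ∉ tileFaces S) ∧ ∀ k : Fin 6, faceL ![0 + a, 0] k ∉ tileFaces S := by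
  have hSd : ∀ c ∈ S, 5 * h ≤ infDist (o + h * triEmbed c) Ωᶜ := fun c hc => ((hS c).1 hc).2
  have hρh : 4000 ≤ ρ / h := by rw [le_div_iff₀ hh]; linarith
  have key : ∀ x : ℤ, |(x : ℝ)| ≤ 9 / 10 * (ρ / h) → o + h * triEmbed ![x, 0] ∉ Ω := by
    intro x hx hin
    have e : triEmbed ![x, 0] = (x : ℂ) := by simp [triEmbed]
    rw [e] at hin
    have hn : ‖((x : ℤ) : ℂ)‖ < ρ / h := by rw [Complex.norm_intCast]; linarith
    have := (hflat1 _ hn).1 hin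
    simp at this
  constructor <;> intro k <;> refine not_mem_tileFaces_of_vertex o hh.le (by linarith) hSd (key _ ?_) k <;> simp <;>
    rw [abs_le] <;> constructor <;> linarith [ha.1, ha.2]

include hh hρ hS ha hdepth1 in
/-- All tiles at the top corners of the gate trapezoid (they are `≥ 13h`-deep). [folklore] -/
theorem top_corners_one : (∀ k : Fin 6, faceL ![0 - a, 0 + 20] k ∈ tileFaces S) ∧
    ∀ k : Fin 6, faceL ![0 + a - 20, 0 + 20] k ∈ tileFaces S := by
  have hSc : ∀ c : Site 2, (c 0 - c 1) % 3 = 0 → 5 * h ≤ infDist (o + h * triEmbed c) Ωᶜ → c ∈ S :=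
    fun c h1 h2 => (hS c).2 ⟨h1, h2⟩
  have hρh : 4000 ≤ ρ / h := by rw [le_div_iff₀ hh]; linarith
  obtain ⟨s2, s17⟩ := sqrt_three_bounds
  have key : ∀ x : ℤ, |(x : ℝ)| + 20 ≤ 9 / 10 * (ρ / h) + 20 → 5 * h + 4 * h ≤ infDist (o + h * triEmbed ![x, 20]) Ωᶜ := by
    intro x hx
    have hn : ‖triEmbed ![x, 20]‖ ≤ |(x : ℝ)| + 20 := by
      refine norm_triEmbed_le _ ?_; simp
    have him : (triEmbed ![x, 20]).im = 20 * (Real.sqrt 3 / 2) := by simp [triEmbed, triZeta_im]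
    have hlt : ‖triEmbed ![x, 20]‖ < ρ / h := by linarith
    have hd := hdepth1 _ hlt
    rw [him] at hd
    have h1 : 9 * h ≤ h * (20 * (Real.sqrt 3 / 2)) := by nlinarith
    have h2 : 9 * h ≤ ρ - h * ‖triEmbed ![x, 20]‖ := by
      have : h * ‖triEmbed ![x, 20]‖ ≤ h * (9 / 10 * (ρ / h) + 20) := by nlinarith
      have e : h * (9 / 10 * (ρ / h) + 20) = 9 / 10 * ρ + 20 * h := by field_simp
      linarith
    have := le_min h1 h2
    linarith
  constructor <;> intro k <;> refine faceL_mem_tileFaces_of_deep_vertex o hh.le hSc (key _ ?_) k <;> simp <;>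
    rw [abs_le] <;> constructor <;> linarith [ha.1, ha.2]

include hh hr₁ hflat0 hp0n hS ha₀ in
/-- No tile at the base corners of the root trapezoid. [folklore] -/
theorem base_corners_zero : (∀ k : Fin 6, faceL ![X₀ - a₀, N] k ∉ tileFaces S) ∧
    ∀ k : Fin 6, faceL ![X₀ + a₀, N] k ∉ tileFaces S := by
  have hSd : ∀ c ∈ S, 5 * h ≤ infDist (o + h * triEmbed c) Ωᶜ := fun c hc => ((hS c).1 hc).2
  have hrh : 4000 ≤ r₁ / h := by rw [le_div_iff₀ hh]; linarith
  have key : ∀ x : ℤ, |(x : ℝ) - X₀| ≤ 9 / 10 * (r₁ / h) → o + h * triEmbed ![x, N] ∉ Ω := by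
    intro x hx hin
    obtain ⟨cY, cX⟩ := coords_triEmbed_sub hp0n ![x, N]
    simp at cY cX
    have him : (triEmbed ![x, N] - p0n).im = 0 := by rw [im_eq_triY, cY, mul_zero]
    have hn : ‖triEmbed ![x, N] - p0n‖ < r₁ / h := by
      have := norm_sub_p0n_le hp0n (u := triEmbed ![x, N]) (A := 9 / 10 * (r₁ / h)) (by rw [cY]; norm_num)
        (by rw [triX_triEmbed]; simpa using hx)
      linarith
    have := (hflat0 _ hn).1 hin
    rw [Complex.sub_im] at him
    linarith
  constructor <;> intro k <;> refine not_mem_tileFaces_of_vertex o hh.le (by linarith) hSd (key _ ?_) k <;> simp <;>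
    rw [abs_le] <;> constructor <;> linarith [ha₀.1, ha₀.2]

include hh hr₁ hp0n hS ha₀ hdepth0 in
/-- All tiles at the top corners of the root trapezoid. [folklore] -/
theorem top_corners_zero : (∀ k : Fin 6, faceL ![X₀ - a₀, N + 20] k ∈ tileFaces S) ∧
    ∀ k : Fin 6, faceL ![X₀ + a₀ - 20, N + 20] k ∈ tileFaces S := by
  have hSc : ∀ c : Site 2, (c 0 - c 1) % 3 = 0 → 5 * h ≤ infDist (o + h * triEmbed c) Ωᶜ → c ∈ S :=
    fun c h1 h2 => (hS c).2 ⟨h1, h2⟩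
  have hrh : 4000 ≤ r₁ / h := by rw [le_div_iff₀ hh]; linarith
  obtain ⟨s2, s17⟩ := sqrt_three_bounds
  have key : ∀ x : ℤ, |(x : ℝ) - X₀| ≤ 9 / 10 * (r₁ / h) →
      5 * h + 4 * h ≤ infDist (o + h * triEmbed ![x, N + 20]) Ωᶜ := by
    intro x hx
    obtain ⟨cY, cX⟩ := coords_triEmbed_sub hp0n ![x, N + 20]
    simp at cY cX
    have him : (triEmbed ![x, N + 20] - p0n).im = Real.sqrt 3 / 2 * 20 := by rw [im_eq_triY, cY]
    have hn : ‖triEmbed ![x, N + 20] - p0n‖ ≤ 9 / 10 * (r₁ / h) + 61 / 2 :=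
      norm_sub_p0n_le hp0n (u := triEmbed ![x, N + 20]) (by rw [cY]; norm_num) (by rw [triX_triEmbed]; simpa using hx)
    have hlt : ‖triEmbed ![x, N + 20] - p0n‖ < r₁ / h := by linarith
    have hd := hdepth0 _ hlt
    rw [him] at hd
    have h1 : 9 * h ≤ h * (Real.sqrt 3 / 2 * 20) := by nlinarith
    have h2 : 9 * h ≤ r₁ - h * ‖triEmbed ![x, N + 20] - p0n‖ := by
      have : h * ‖triEmbed ![x, N + 20] - p0n‖ ≤ h * (9 / 10 * (r₁ / h) + 61 / 2) := by nlinarith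
      have e : h * (9 / 10 * (r₁ / h) + 61 / 2) = 9 / 10 * r₁ + 61 / 2 * h := by field_simp
      linarith
    have := le_min h1 h2
    linarith
  constructor <;> intro k <;> refine faceL_mem_tileFaces_of_deep_vertex o hh.le hSc (key _ ?_) k <;> simp <;>
    rw [abs_le] <;> constructor <;> linarith [ha₀.1, ha₀.2]

include hh hρ hr₁ hp0n hdist ha ha₀ hR₁ hR₀ in
/-- **The two trapezoids are far apart**: no vertex has faces in both. [folklore] -/
theorem trapezoids_separated (y : Site 2) : (∀ k : Fin 6, faceL y k ∉ R₁) ∨ (∀ k : Fin 6, faceL y k ∉ R₀) := by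
  by_contra hcon
  simp only [not_or, not_forall, not_not] at hcon
  obtain ⟨⟨k, hk⟩, ⟨k', hk'⟩⟩ := hcon
  have hy1 : y ∈ hexFaceVertices (faceL y k) := by rw [hexFaceVertices_faceL]; simp
  have hy0 : y ∈ hexFaceVertices (faceL y k') := by rw [hexFaceVertices_faceL]; simp
  obtain ⟨a1, a2, a3, a4⟩ := (hR₁ _).1 hk y hy1
  obtain ⟨b1, b2, b3, b4⟩ := (hR₀ _).1 hk' y hy0
  -- near the gate pin
  have hn1 : ‖triEmbed y‖ ≤ a + 20 := by
    refine norm_triEmbed_le y ?_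
    have i0 : |(y 0 : ℝ)| ≤ a := by
      rw [abs_le]; constructor
      · have : ((0 : ℤ) : ℝ) - a ≤ y 0 := by exact_mod_cast a3
        simpa using this
      · have : ((y 0 : ℤ) : ℝ) - 0 + (y 1 - 0) ≤ a := by exact_mod_cast a4
        have : ((0 : ℤ) : ℝ) ≤ y 1 := by exact_mod_cast a1
        push_cast at *; linarith
    have i1 : |(y 1 : ℝ)| ≤ 20 := by
      rw [abs_le]; constructor
      · have : ((0 : ℤ) : ℝ) ≤ y 1 := by exact_mod_cast a1
        push_cast at this; linarith
      · have : ((y 1 : ℤ) : ℝ) ≤ 0 + 20 := by exact_mod_cast a2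
        linarith
    linarith
  -- near the root pin
  have hn0 : ‖triEmbed y - p0n‖ ≤ a₀ + 61 / 2 := by
    obtain ⟨cY, cX⟩ := coords_triEmbed_sub hp0n y
    refine norm_sub_p0n_le hp0n ⟨?_, ?_⟩ ?_
    · rw [cY]; have : ((N : ℤ) : ℝ) ≤ y 1 := by exact_mod_cast b1
      linarith
    · rw [cY]; have : ((y 1 : ℤ) : ℝ) ≤ N + 20 := by exact_mod_cast b2
      linarith
    · rw [triX_triEmbed, abs_le]; constructor
      · have : ((X₀ : ℤ) : ℝ) - a₀ ≤ y 0 := by exact_mod_cast b3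
        linarith
      · have : ((y 0 : ℤ) : ℝ) - X₀ + (y 1 - N) ≤ a₀ := by exact_mod_cast b4
        have : ((N : ℤ) : ℝ) ≤ y 1 := by exact_mod_cast b1
        linarith
  have hρh : 4000 ≤ ρ / h := by rw [le_div_iff₀ hh]; linarith
  have hrh : 4000 ≤ r₁ / h := by rw [le_div_iff₀ hh]; linarith
  have : ‖p0n‖ ≤ ‖triEmbed y‖ + ‖triEmbed y - p0n‖ := by
    have := norm_sub_le (triEmbed y) (triEmbed y - p0n)
    rwa [sub_sub_cancel] at this
  linarith [ha.1, ha₀.1]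

include hh hρ hr₁ hflat1 hflat0 hp0n hdist ha ha₀ hS hR₁ hR₀ hdepth1 hdepth0 in
/-- **`K = tileFaces S ∪ R₁ ∪ R₀` is pinch-free.** [folklore] -/
theorem K_noPinch (y : Site 2) :
    (Finset.univ.filter fun k : Fin 6 =>
      faceL y k ∈ tileFaces S ∪ R₁ ∪ R₀ ∧ faceL y (k + 1) ∉ tileFaces S ∪ R₁ ∪ R₀).card ≤ 1 := by
  have hS3 : ∀ c ∈ S, (c 0 - c 1) % 3 = 0 := fun c hc => ((hS c).1 hc).1
  have hρh : 4000 ≤ ρ / h := by rw [le_div_iff₀ hh]; linarith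
  have hrh : 4000 ≤ r₁ / h := by rw [le_div_iff₀ hh]; linarith
  have ha20 : 20 < a + a := by
    have : (20 : ℝ) < a + a := by linarith [ha.2]
    exact_mod_cast this
  have ha20' : 20 < a₀ + a₀ := by
    have : (20 : ℝ) < a₀ + a₀ := by linarith [ha₀.2]
    exact_mod_cast this
  obtain ⟨bc1, bc2⟩ := base_corners_one hh hρ hflat1 ha hS
  obtain ⟨tc1, tc2⟩ := top_corners_one hh hρ ha hS hdepth1
  obtain ⟨bz1, bz2⟩ := base_corners_zero hh hr₁ hflat0 hp0n ha₀ hS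
  obtain ⟨tz1, tz2⟩ := top_corners_zero hh hr₁ hp0n ha₀ hS hdepth0
  have h1 := trapezoid_union_tiles_noPinch S R₁ a a 20 0 0 hS3 hR₁ (by norm_num) ha20 bc1 bc2 tc1 tc2
  have h0 := trapezoid_union_tiles_noPinch S R₀ a₀ a₀ 20 X₀ N hS3 hR₀ (by norm_num) ha20' bz1 bz2 tz1 tz2
  exact union_two_noPinch S R₁ R₀ h1 h0 (trapezoids_separated hh hρ hr₁ hp0n hdist ha ha₀ hR₁ hR₀) y

/-! ### 3. The anchor dart and the cells of `K` -/

include hh hρ hr₁ hflat1 hp0n hdist ha ha₀ hS hR₁ hR₀ in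
/-- **The anchor dart**: `0 → triDir 0` (along the gate from `pt 1`) is a boundary dart of `K`:
its left face `faceL 0 0` is in the gate trapezoid, its right face `faceL 0 5` has a vertex below
the gate (not in `R₁`), the vertex `0 ↦ pt 1 ∉ Ω` (not in a tile) far from the root (not in `R₀`).
[folklore] -/
theorem d0_mem_bdDarts : ((0 : Site 2), (0 : Fin 6)) ∈ bdDarts (tileFaces S ∪ R₁ ∪ R₀) := by
  have hρh : 4000 ≤ ρ / h := by rw [le_div_iff₀ hh]; linarith
  have hrh : 4000 ≤ r₁ / h := by rw [le_div_iff₀ hh]; linarith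
  have ha1 : 1 ≤ a := by
    have : (1 : ℝ) ≤ a := by linarith [ha.2]
    exact_mod_cast this
  have ha0 : 0 ≤ a := by omega
  rw [mem_bdDarts]
  simp only
  constructor
  · -- left face in `R₁`
    refine Finset.mem_union_left _ (Finset.mem_union_right _ ((hR₁ _).2 fun v hv => ?_))
    rw [hexFaceVertices_faceL] at hv
    simp [triDir] at hv
    rcases hv with rfl | rfl | rfl <;> simp <;> omega
  · intro hmem
    rcases Finset.mem_union.1 hmem with hmem | hmem
    · rcases Finset.mem_union.1 hmem with hmem | hmem
      · -- not a tile: the vertex `0` is `pt 1 ∉ Ω`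
        have hSd : ∀ c ∈ S, 5 * h ≤ infDist (o + h * triEmbed c) Ωᶜ := fun c hc => ((hS c).1 hc).2
        refine not_mem_tileFaces_of_vertex o hh.le (by linarith) hSd (v := 0) ?_ (0 + 5) hmem
        intro hin
        have := (hflat1 (triEmbed 0) (by rw [triEmbed_zero, norm_zero]; positivity)).1 hin
        simp at this
      · -- not in `R₁`: the vertex `triDir 5 = (1, -1)`
        have hv : (0 : Site 2) + triDir (0 + 5) ∈ hexFaceVertices (faceL 0 (0 + 5)) := by
          rw [hexFaceVertices_faceL]; simp
        have := ((hR₁ _).1 hmem _ hv).1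
        simp [triDir] at this
    · -- not in `R₀`: the vertex `0` is far from the root pin
      have hv : (0 : Site 2) ∈ hexFaceVertices (faceL 0 (0 + 5)) := by rw [hexFaceVertices_faceL]; simp
      obtain ⟨b1, b2, b3, b4⟩ := (hR₀ _).1 hmem _ hv
      simp at b1 b2 b3 b4
      have hn0 : ‖triEmbed 0 - p0n‖ ≤ a₀ + 61 / 2 := by
        obtain ⟨cY, cX⟩ := coords_triEmbed_sub hp0n 0
        refine norm_sub_p0n_le hp0n ⟨?_, ?_⟩ ?_
        · rw [cY]; have : ((N : ℤ) : ℝ) ≤ 0 := by exact_mod_cast b1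
          simpa using this
        · rw [cY]; have : (0 : ℝ) ≤ (N : ℝ) + 20 := by exact_mod_cast b2
          simp; linarith
        · rw [triX_triEmbed, abs_le]; constructor
          · have : ((X₀ : ℤ) : ℝ) ≤ a₀ := by exact_mod_cast b3
            simp; linarith
          · have : -((X₀ : ℤ) : ℝ) ≤ a₀ + N := by exact_mod_cast b4
            have : ((N : ℤ) : ℝ) ≤ 0 := by exact_mod_cast b1
            simp; linarith
      rw [triEmbed_zero, zero_sub, norm_neg] at hn0
      linarith [ha₀.1]

include hh hρ hr₁ hflat1 hflat0 hp0n ha ha₀ hS hR₁ hR₀ in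
/-- **Where the closed cells of `K` are**: a point of a closed `K`-cell is in `Ω`, or on the gate base
(`im w = 0`, `‖w‖ ≤ a + 24`), or on the root base (`im w = im p0n`, `‖w - p0n‖ ≤ a₀ + 49/2`).
[folklore] -/
theorem K_cell_cases {F : HexVertex} (hF : F ∈ tileFaces S ∪ R₁ ∪ R₀) {w : ℂ} (hw : w ∈ triCell F) :
    o + h * w ∈ Ω ∨ (w.im = 0 ∧ ‖w‖ ≤ a + 24) ∨ (w.im = p0n.im ∧ ‖w - p0n‖ ≤ a₀ + 49 / 2) := by
  have hρh : 4000 ≤ ρ / h := by rw [le_div_iff₀ hh]; linarith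
  have hrh : 4000 ≤ r₁ / h := by rw [le_div_iff₀ hh]; linarith
  have ha0 : 0 ≤ a := by
    have : (0 : ℝ) ≤ a := by linarith [ha.2]
    exact_mod_cast this
  rcases Finset.mem_union.1 hF with hF | hF
  · rcases Finset.mem_union.1 hF with hF | hF
    · -- tile: deep, hence in `Ω`
      left
      have hSd : ∀ c ∈ S, 5 * h ≤ infDist (o + h * triEmbed c) Ωᶜ := fun c hc => ((hS c).1 hc).2
      have := tile_cell_deep o hh.le hSd hF hw
      exact mem_of_infDist_pos (by linarith)
    · -- gate trapezoid
      have ha0' : 0 ≤ a := ha0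
      obtain ⟨him, hn⟩ := trapezoid_cell_bounds ha0' ha0' (by norm_num) hR₁ hF hw
      have e0 : triEmbed (![0, 0] : Site 2) = 0 := by simp [triEmbed]
      rw [e0, sub_zero, max_self] at hn
      push_cast at him hn
      simp only [mul_zero] at him
      rcases him.lt_or_eq with hlt | heq
      · left
        refine (hflat1 w ?_).2 hlt
        linarith [ha.1]
      · exact Or.inr (Or.inl ⟨heq.symm, by linarith⟩)
  · -- root trapezoid
    have ha0' : 0 ≤ a₀ := by
      have : (0 : ℝ) ≤ a₀ := by linarith [ha₀.2]
      exact_mod_cast this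
    obtain ⟨him, hn⟩ := trapezoid_cell_bounds ha0' ha0' (by norm_num) hR₀ hF hw
    rw [max_self] at hn
    push_cast at hn
    -- the base lattice point is within `1/2` of `p0n`
    have hbase : ‖triEmbed (![X₀, N] : Site 2) - p0n‖ ≤ 1 / 2 := by
      obtain ⟨cY, cX⟩ := coords_triEmbed_sub hp0n ![X₀, N]
      simp at cY cX
      have hre := re_eq_triX_add (triEmbed ![X₀, N] - p0n)
      have him' := im_eq_triY (triEmbed ![X₀, N] - p0n)
      rw [cY] at hre him'
      rw [cX] at hre
      simp only [mul_zero, zero_div, add_zero] at hre him'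
      have h2 := abs_le.1 hp0n.2
      have : |(triEmbed ![X₀, N] - p0n).re| ≤ 1 / 2 := by rw [hre, abs_le]; constructor <;> linarith
      have h0 : |(triEmbed ![X₀, N] - p0n).im| = 0 := by rw [him', abs_zero]
      linarith [Complex.norm_le_abs_re_add_abs_im (triEmbed ![X₀, N] - p0n)]
    have hn' : ‖w - p0n‖ ≤ a₀ + 49 / 2 := by
      calc ‖w - p0n‖ = ‖(w - triEmbed ![X₀, N]) + (triEmbed ![X₀, N] - p0n)‖ := by rw [sub_add_sub_cancel]
        _ ≤ ‖w - triEmbed ![X₀, N]‖ + ‖triEmbed ![X₀, N] - p0n‖ := norm_add_le _ _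
        _ ≤ (a₀ + 20 + 4) + 1 / 2 := add_le_add hn hbase
        _ = a₀ + 49 / 2 := by ring
    have hp0im : p0n.im = Real.sqrt 3 / 2 * N := by rw [im_eq_triY, hp0n.1]
    rw [← hp0im] at him
    rcases him.lt_or_eq with hlt | heq
    · left
      refine (hflat0 w ?_).2 hlt
      linarith [ha₀.1]
    · exact Or.inr (Or.inr ⟨heq.symm, hn'⟩)

end Grid

/-- **The face set `tileFaces S ∪ R₁ ∪ R₀` of the inner polygon is pinch-free** (registered form, sub-goal
of `stub_innerZigzagPolygon`). [folklore] -/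
theorem faceSet_noPinch : ∀ (Ω : Set ℂ) (o p0n : ℂ) (h ρ r₁ : ℝ) (N X₀ a a₀ : ℤ) (S : Finset (Site 2)) (R₁ R₀ : Finset HexVertex), 0 < h → 4000 * h ≤ ρ → 4000 * h ≤ r₁ → (∀ w : ℂ, ‖w‖ < ρ / h → (o + h * w ∈ Ω ↔ 0 < w.im)) → (∀ w : ℂ, ‖w - p0n‖ < r₁ / h → (o + h * w ∈ Ω ↔ p0n.im < w.im)) → (triY p0n = N ∧ |triX p0n - X₀| ≤ 1 / 2) → ρ / h + r₁ / h ≤ ‖p0n‖ → ((a : ℝ) ≤ 9 / 10 * (ρ / h) ∧ 9 / 10 * (ρ / h) - 1 < a) → ((a₀ : ℝ) ≤ 9 / 10 * (r₁ / h) ∧ 9 / 10 * (r₁ / h) - 1 < a₀) → (∀ c : Site 2, c ∈ S ↔ (c 0 - c 1) % 3 = 0 ∧ 5 * h ≤ Metric.infDist (o + h * triEmbed c) Ωᶜ) → (∀ F : HexVertex, F ∈ R₁ ↔ ∀ v ∈ hexFaceVertices F, 0 ≤ v 1 ∧ v 1 ≤ 0 + 20 ∧ 0 - a ≤ v 0 ∧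 (v 0 - 0) + (v 1 - 0) ≤ a) → (∀ F : HexVertex, F ∈ R₀ ↔ ∀ v ∈ hexFaceVertices F, N ≤ v 1 ∧ v 1 ≤ N + 20 ∧ X₀ - a₀ ≤ v 0 ∧ (v 0 - X₀) + (v 1 - N) ≤ a₀) → (∀ w : ℂ, ‖w‖ < ρ / h → min (h * w.im) (ρ - h * ‖w‖) ≤ Metric.infDist (o + h * w) Ωᶜ) → (∀ w : ℂ, ‖w - p0n‖ < r₁ / h → min (h * (w - p0n).im) (r₁ - h * ‖w - p0n‖) ≤ Metric.infDist (o + h * w) Ωᶜ) → ∀ y : Site 2, (Finset.univ.filter fun k : Fin 6 => faceL y k ∈ tileFaces S ∪ R₁ ∪ R₀ ∧ faceL y (k + 1) ∉ tileFaces S ∪ R₁ ∪ R₀).card ≤ 1 :=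
  fun _ _ _ _ _ _ _ _ _ _ _ _ _ hh hρ hr₁ hflat1 hflat0 hp0n hdist ha ha₀ hS hR₁ hR₀ hdepth1 hdepth0 y =>
    K_noPinch hh hρ hr₁ hflat1 hflat0 hp0n hdist ha ha₀ hS hR₁ hR₀ hdepth1 hdepth0 y

end Summit.CriticalPhenomena.SAWScalingLimit.Theorems.PolygonParitySqueeze.InnerZigzag

end
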